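import Summits.HodgeConjecture.CorCM.Census.QuarticTwistOriented
import Summits.HodgeConjecture.CorCM.Census.QuarticTwistCount

/-!
# The quartic twist `(ℤ/4 × B, (2,0))`, XI: UPPER ENDS — minimising regimes, the upper end of a tie, coherence of moves, the upper ends
# of atoms and of the six closing corners, and an ORIENTED cross square through every non-residual type (any parity of `|B|`)

COR-CM (cell `pub-hodgecm2`), count-neutral kernel combinatorics by the binder seat b09 (gen 32; lane QUARTIC-TWIST), part XI, sequel of parts VIII
(`QuarticTwistCount`) and X (`QuarticTwistOriented`).  Two bookkeeping definitions (`IsMin`, `IsUpper`) + theorems; no `decide` table (closed `ℤ/4`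
trivia by `decide`), no certificate, no named fact, no geometry, no `sorry`.  HONEST FRAMING: `HC_CM` is NOT proved; nothing here is a headline or a period.

UPPER ENDS.  `IsMin u s :↔ L u s = Φ s`; `IsUpper u s :↔ IsMin u s ∧ ¬ IsMin (u+1) s`.  The minimising regimes of a clock type form `{u}`, a pair
`{u−1, u}`, or all four (`all_min_of_min_add_two`); so the upper end is unique (`isUpper_unique`) and exists unless the type is BALANCED (all four
regimes minimise; `exists_isUpper`).  Upper ends are transported by twists (`isUpper_tw_iff`).  COHERENCE: a `±1` move lowering `Lee(· − u)` keeps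
the upper end `u` and lowers `Φ` by one (`isUpper_move`, lemma K); from a balanced type, a move lowering both `Lee(· − u)` and `Lee(· − (u−1))`
produces upper end `u` (`isUpper_move_of_balanced`, lemma K4, via `lee_away`).  Atoms have upper end their regime (`isUpper_atom`, `|B| ≥ 3`); the
six closing corners at `|Q| = a`, `|B| ∈ {2a+1, 2a+2}` have upper ends `𝟙_Q, 𝟙_Q − δ_i ↦ 0` and `𝟙_{Q+i}, 𝟙_Q + 2δ_i, 𝟙_{Q+j}, 𝟙_{Q+i+j} ↦ 1`
(`isUpper_corners`).  ORIENTED SQUARES (`exists_orientedSquare`): through every non-residual type `s` there is a cross square whose three other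
corners have smaller `Φ` and a COMMON upper end `u`, equal to the upper end of `s` when `s` is not balanced (two columns off `u`, steps toward `u`);
for balanced `s` two columns with equal or adjacent values `x, x'` (`exists_two_adjacent`, `|B| ≥ 3`) are moved toward `{x−2, x−1}` and `u = x − 1`.
Part XII assembles the parity-free generating family from these.  All [folklore].

## References
* [Pohlmann1968] H. Pohlmann, Algebraic cycles on abelian varieties of complex multiplication type, Ann. of Math. 88 (1968), Thm 1.
-/

namespace Summit.HodgeConjecture.CorCM.Census.QuarticTwist

open Finset

variable (B : Type) [AddGroup B] [Fintype B] [DecidableEq B]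

/-! ## §1 Minimising regimes and upper ends -/

/-- `u` is a minimising regime of `s`. [folklore] -/
def IsMin (u : ZMod 4) (s : Ty B) : Prop := L B u s = Phi B s

/-- `u` is the **upper end** of `s`: `u` minimises and `u + 1` does not. [folklore] -/
def IsUpper (u : ZMod 4) (s : Ty B) : Prop := IsMin B u s ∧ ¬ IsMin B (u + 1) s

omit [AddGroup B] [DecidableEq B] in
/-- Opposite minimisers force all four regimes to minimise. [folklore] -/
theorem all_min_of_min_add_two {s : Ty B} {u : ZMod 4} (h0 : IsMin B u s) (h2 : IsMin B (u + 2) s) (w : ZMod 4) : IsMin B w s := by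
  unfold IsMin at *
  have ha := L_add_L_add_two B u s
  have hb := L_add_L_add_two B (u + 1) s
  rw [show u + 1 + 2 = u + 3 by ring] at hb
  have h1 := Phi_le B (u + 1) s
  have h3 := Phi_le B (u + 3) s
  have key : ∀ w u : ZMod 4, w = u ∨ w = u + 1 ∨ w = u + 2 ∨ w = u + 3 := by decide
  rcases key w u with rfl | rfl | rfl | rfl
  · exact h0
  · omega
  · exact h2
  · omega

omit [AddGroup B] [DecidableEq B] in
/-- **Uniqueness of the upper end.** [folklore] -/
theorem isUpper_unique {s : Ty B} {u u' : ZMod 4} (hu : IsUpper B u s) (hu' : IsUpper B u' s) : u' = u := by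
  have key : ∀ a b : ZMod 4, a = b ∨ a = b + 1 ∨ a = b + 2 ∨ b = a + 1 := by decide
  rcases key u' u with h | h | h | h
  · exact h
  · exact absurd (h ▸ hu'.1) hu.2
  · exact absurd (all_min_of_min_add_two B hu.1 (h ▸ hu'.1) (u + 1)) hu.2
  · exact absurd (h ▸ hu.1) hu'.2

omit [AddGroup B] [DecidableEq B] in
/-- **Existence of the upper end**: a type that is not balanced has an upper end. [folklore] -/
theorem exists_isUpper {s : Ty B} (h : ¬ ∀ w, IsMin B w s) : ∃ u, IsUpper B u s := by
  obtain ⟨w₀, hw₀⟩ := exists_L_eq_Phi B s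
  have h0 : IsMin B w₀ s := hw₀
  by_contra hne
  have next : ∀ w, IsMin B w s → IsMin B (w + 1) s := fun w hw => by
    by_contra hw1
    exact hne ⟨w, hw, hw1⟩
  have h1 := next _ h0
  have h2 := next _ h1
  have h3 := next _ h2
  rw [show w₀ + 1 + 1 = w₀ + 2 by ring] at h2
  rw [show w₀ + 1 + 1 + 1 = w₀ + 3 by ring] at h3
  have key : ∀ w u : ZMod 4, w = u ∨ w = u + 1 ∨ w = u + 2 ∨ w = u + 3 := by decide
  refine h fun w => ?_
  rcases key w w₀ with rfl | rfl | rfl | rfl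
  · exact h0
  · exact h1
  · exact h2
  · exact h3

omit [DecidableEq B] in
/-- Minimisers are transported by twists: `IsMin u (tw (v,t) s) ↔ IsMin (u − v) s`. [folklore] -/
theorem isMin_tw (g : ZMod 4 × B) (u : ZMod 4) (s : Ty B) : IsMin B u (tw B g s) ↔ IsMin B (u - g.1) s := by
  unfold IsMin; rw [L_tw, Phi_tw]

omit [DecidableEq B] in
/-- **Upper ends are transported by twists**: `IsUpper u ((v,t)·s) ↔ IsUpper (u − v) s`. [folklore] -/
theorem isUpper_tw_iff (g : ZMod 4 × B) (u : ZMod 4) (s : Ty B) : IsUpper B u (tw B g s) ↔ IsUpper B (u - g.1) s := by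
  unfold IsUpper
  rw [isMin_tw, isMin_tw, show u + 1 - g.1 = u - g.1 + 1 by ring]

/-! ## §2 Coherence of moves toward the upper end -/

/-- A move toward `u` and toward `u − 1` raises the Lee weight relative to `u + 1`. [folklore] -/
theorem lee_away (x u e : ZMod 4) (he : e = 1 ∨ e = -1) (h0 : lee (x + e - u) + 1 = lee (x - u))
    (h1 : lee (x + e - (u - 1)) + 1 = lee (x - (u - 1))) : lee (x + e - (u + 1)) = lee (x - (u + 1)) + 1 := by
  have key : ∀ x u : ZMod 4, (lee (x + 1 - u) + 1 = lee (x - u) → lee (x + 1 - (u - 1)) + 1 = lee (x - (u - 1)) →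
      lee (x + 1 - (u + 1)) = lee (x - (u + 1)) + 1) ∧ (lee (x + -1 - u) + 1 = lee (x - u) → lee (x + -1 - (u - 1)) + 1 = lee (x - (u - 1)) →
      lee (x + -1 - (u + 1)) = lee (x - (u + 1)) + 1) := by decide
  rcases he with rfl | rfl
  · exact (key x u).1 h0 h1
  · exact (key x u).2 h0 h1

omit [AddGroup B] in
/-- A move that raises the Lee weight at its column raises `L u` by one. [folklore] -/
theorem L_move_away (u : ZMod 4) (s : Ty B) (b : B) (e : ZMod 4) (h : lee (s b + e - u) = lee (s b - u) + 1) :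
    L B u (s + Pi.single b e) = L B u s + 1 := by
  have h1 := L_eq_add_erase B u (s + Pi.single b e : Ty B) b
  have h2 := L_eq_add_erase B u s b
  have hrest : ∑ x ∈ univ.erase b, lee ((s + Pi.single b e : Ty B) x - u) = ∑ x ∈ univ.erase b, lee (s x - u) := by
    refine Finset.sum_congr rfl ?_
    intro x hx
    rw [Pi.add_apply, Pi.single_eq_of_ne (ne_of_mem_erase hx), add_zero]
  rw [hrest, Pi.add_apply, Pi.single_eq_same] at h1
  omega

omit [AddGroup B] in
/-- **Lemma K (coherence).**  If `u` is the upper end of `s` and the `±1` move `e` at `b` lowers `Lee(· − u)`, then `u` is the upper end of the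
moved type, whose potential is `Φ s − 1`. [folklore] -/
theorem isUpper_move {s : Ty B} {u : ZMod 4} (hu : IsUpper B u s) (b : B) (e : ZMod 4) (he : e = 1 ∨ e = -1)
    (h : lee (s b + e - u) + 1 = lee (s b - u)) : IsUpper B u (s + Pi.single b e) ∧ Phi B (s + Pi.single b e) + 1 = Phi B s := by
  obtain ⟨hu, hu1⟩ := hu
  unfold IsMin at *
  have hd := L_move_toward B u s b e h
  have hlow := Phi_le_Phi_move_add_one B s b e he
  have hP := Phi_le B u (s + Pi.single b e)
  have hΦ : Phi B (s + Pi.single b e) + 1 = Phi B s := by omega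
  refine ⟨⟨by unfold IsMin; omega, ?_⟩, hΦ⟩
  unfold IsMin
  have h1 := L_move B (u + 1) s b e he
  have h1' := Phi_le B (u + 1) s
  omega

omit [AddGroup B] in
/-- **Lemma K4 (coherence from a balanced type).**  If all regimes minimise `s` and the move lowers both `Lee(· − u)` and `Lee(· − (u − 1))`, then
`u` is the upper end of the moved type, whose potential is `Φ s − 1`. [folklore] -/
theorem isUpper_move_of_balanced {s : Ty B} (hall : ∀ w, IsMin B w s) (u : ZMod 4) (b : B) (e : ZMod 4) (he : e = 1 ∨ e = -1)
    (h0 : lee (s b + e - u) + 1 = lee (s b - u)) (h1 : lee (s b + e - (u - 1)) + 1 = lee (s b - (u - 1))) :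
    IsUpper B u (s + Pi.single b e) ∧ Phi B (s + Pi.single b e) + 1 = Phi B s := by
  have hu := hall u
  have hu1 := hall (u + 1)
  unfold IsUpper IsMin at *
  have hd := L_move_toward B u s b e h0
  have hup := L_move_away B (u + 1) s b e (lee_away (s b) u e he h0 h1)
  have hlow := Phi_le_Phi_move_add_one B s b e he
  have hP := Phi_le B u (s + Pi.single b e)
  exact ⟨⟨by omega, by omega⟩, by omega⟩

/-! ## §3 Atoms and the six closing corners -/

omit [AddGroup B] in
/-- **Atoms have upper end their regime** (`|B| ≥ 3`). [folklore] -/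
theorem isUpper_atom (h3 : 3 ≤ Fintype.card B) (u : ZMod 4) (b : B) (k : ZMod 4) : IsUpper B u (atom B u b k) := by
  have hL : ∀ u', L B u' (atom B u b k) = lee (u + k - u') + (Fintype.card B - 1) * lee (u - u') := fun u' => L_atom_other B u b k u'
  have hself : L B u (atom B u b k) = lee k := L_atom_self B u b k
  have hk2 := lee_le_two k
  -- `L u ≤ L u'` for all `u'`
  have hle : ∀ u', L B u (atom B u b k) ≤ L B u' (atom B u b k) := by
    intro u'
    by_cases h : u' = u
    · rw [h]
    · rw [hself, hL u']
      have h1 : 1 ≤ lee (u - u') := by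
        have := (lee_eq_zero_iff (u - u')).not.mpr (sub_ne_zero.mpr (Ne.symm h)); omega
      have : 2 ≤ (Fintype.card B - 1) * lee (u - u') :=
        le_trans (by omega) (Nat.mul_le_mul (Nat.le_sub_one_of_lt (by omega : 2 < Fintype.card B)) h1)
      omega
  have hmin : IsMin B u (atom B u b k) := by
    unfold IsMin
    obtain ⟨u', hu'⟩ := exists_L_eq_Phi B (atom B u b k)
    exact le_antisymm (hu' ▸ hle u') (Phi_le B u _)
  have hnot : ¬ IsMin B (u + 1) (atom B u b k) := by
    unfold IsMin
    rw [← hmin, hself, hL (u + 1), show u + k - (u + 1) = k - 1 by ring, show u - (u + 1) = -1 by ring, show lee (-1 : ZMod 4) = 1 by decide,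
      mul_one]
    have key : ∀ k : ZMod 4, lee k ≤ lee (k - 1) + 1 := by decide
    have := key k
    omega
  exact ⟨hmin, hnot⟩

omit [AddGroup B] in
/-- **Upper ends of the six closing corners** (`|Q| = a`, `|B| = 2a + 1` or `2a + 2`, `a ≥ 1`, `i ≠ j ∉ Q`): `𝟙_Q ↦ 0`, `𝟙_{Q+i} ↦ 1`,
`𝟙_Q − δ_i ↦ 0`, `𝟙_Q + 2δ_i ↦ 1`, `𝟙_{Q+j} ↦ 1`, `𝟙_{Q+i+j} ↦ 1` (for `|B|` even three of them are ties `{0,1}`). [folklore] -/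
theorem isUpper_corners {a : ℕ} (ha : 1 ≤ a) (hn : Fintype.card B = 2 * a + 1 ∨ Fintype.card B = 2 * a + 2) (Q : Finset B) (hQ : Q.card = a)
    {i j : B} (hi : i ∉ Q) (hj : j ∉ Q) (hji : j ≠ i) :
    IsUpper B 0 (prof B Q i 0) ∧ IsUpper B 1 (prof B Q i 1) ∧ IsUpper B 0 (prof B Q i (-1)) ∧ IsUpper B 1 (prof B Q i 2) ∧
      IsUpper B 1 (prof B (insert j Q) i 0) ∧ IsUpper B 1 (prof B (insert j Q) i 1) := by
  have hi' : i ∉ insert j Q := fun h => (mem_insert.mp h).elim (fun h => hji h.symm) hi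
  have hQ' : (insert j Q).card = a + 1 := by rw [card_insert_of_notMem hj, hQ]
  have key : ∀ u : ZMod 4, u = 0 ∨ u = 1 ∨ u = 2 ∨ u = 3 := by decide
  have z4 : ((-1 : ZMod 4) = 3 ∧ lee 0 = 0 ∧ lee 1 = 1 ∧ lee 2 = 2 ∧ lee 3 = 1) ∧
      ((1 : ZMod 4) - 0 = 1 ∧ (1 : ZMod 4) - 1 = 0 ∧ (1 : ZMod 4) - 2 = 3 ∧ (1 : ZMod 4) - 3 = 2 ∧ (0 : ZMod 4) - 0 = 0 ∧
        (0 : ZMod 4) - 1 = 3 ∧ (0 : ZMod 4) - 2 = 2 ∧ (0 : ZMod 4) - 3 = 1) ∧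
      ((2 : ZMod 4) - 0 = 2 ∧ (2 : ZMod 4) - 1 = 1 ∧ (2 : ZMod 4) - 2 = 0 ∧ (2 : ZMod 4) - 3 = 3 ∧ (3 : ZMod 4) - 0 = 3 ∧
        (3 : ZMod 4) - 1 = 2 ∧ (3 : ZMod 4) - 2 = 1 ∧ (3 : ZMod 4) - 3 = 0 ∧ (0 : ZMod 4) + 1 = 1 ∧ (1 : ZMod 4) + 1 = 2) := by decide
  -- orientation from the four potentials: `u` minimises everything and beats `u + 1` strictly
  have tac : ∀ (Q : Finset B) (c : ℕ), Q.card = c → i ∉ Q → ∀ (x u : ZMod 4),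
      (∀ u', c * lee (1 - u) + lee (x - u) + (Fintype.card B - c - 1) * lee (0 - u)
        ≤ c * lee (1 - u') + lee (x - u') + (Fintype.card B - c - 1) * lee (0 - u')) →
      (c * lee (1 - u) + lee (x - u) + (Fintype.card B - c - 1) * lee (0 - u)
        < c * lee (1 - (u + 1)) + lee (x - (u + 1)) + (Fintype.card B - c - 1) * lee (0 - (u + 1))) → IsUpper B u (prof B Q i x) := by
    intro Q c hc hiQ x u hle hlt
    have hmin : IsMin B u (prof B Q i x) := by
      unfold IsMin
      obtain ⟨u', hu'⟩ := exists_L_eq_Phi B (prof B Q i x)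
      refine le_antisymm ?_ (Phi_le B u _)
      rw [← hu', L_prof B Q hiQ, L_prof B Q hiQ, hc]; exact hle u'
    refine ⟨hmin, ?_⟩
    unfold IsMin at hmin ⊢
    rw [← hmin, L_prof B Q hiQ, L_prof B Q hiQ, hc]
    exact Nat.ne_of_gt hlt
  refine ⟨tac Q a hQ hi 0 0 ?_ ?_, tac Q a hQ hi 1 1 ?_ ?_, tac Q a hQ hi (-1) 0 ?_ ?_, tac Q a hQ hi 2 1 ?_ ?_,
    tac _ (a + 1) hQ' hi' 0 1 ?_ ?_, tac _ (a + 1) hQ' hi' 1 1 ?_ ?_⟩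
  all_goals first
    | (intro u'; rcases key u' with rfl | rfl | rfl | rfl <;> simp only [z4] <;> rcases hn with hn | hn <;> omega)
    | (simp only [z4]; rcases hn with hn | hn <;> omega)

/-! ## §4 An oriented cross square through every non-residual type -/

omit [AddGroup B] in
/-- A non-residual type has two columns off any given value. [folklore] -/
theorem exists_two_off' (h3 : 3 ≤ Fintype.card B) {s : Ty B} (hs : ¬ IsRes B s) (u : ZMod 4) :
    ∃ b₁ b₂ : B, b₁ ≠ b₂ ∧ s b₁ ≠ u ∧ s b₂ ≠ u := by
  classical
  obtain ⟨b₀⟩ : Nonempty B := Fintype.card_pos_iff.mp (by omega)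
  by_cases hall : ∀ b, s b = u
  · exact (hs ⟨u, b₀, 0, funext fun x => by rw [atom_apply, add_zero, hall x]; split_ifs <;> rfl⟩).elim
  · obtain ⟨b₁, hb₁⟩ := not_forall.mp hall
    by_cases hall2 : ∀ b, b ≠ b₁ → s b = u
    · refine (hs ⟨u, b₁, s b₁ - u, funext fun x => ?_⟩).elim
      rw [atom_apply]
      by_cases hx : x = b₁
      · rw [if_pos hx, hx]; ring
      · rw [if_neg hx, hall2 x hx]
    · obtain ⟨b₂, hb₂⟩ := not_forall.mp hall2
      obtain ⟨hne, hb₂'⟩ := Classical.not_imp.mp hb₂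
      exact ⟨b₂, b₁, hne, hb₂', hb₁⟩

omit [AddGroup B] [DecidableEq B] in
/-- On `|B| ≥ 3` columns every type has two columns with equal or adjacent values. [folklore] -/
theorem exists_two_adjacent (h3 : 3 ≤ Fintype.card B) (s : Ty B) : ∃ b₁ b₂ : B, b₁ ≠ b₂ ∧ (s b₂ = s b₁ ∨ s b₂ = s b₁ + 1) := by
  have h2 : 2 < (univ : Finset B).card := by rw [card_univ]; omega
  obtain ⟨a, -, b, -, c, -, hab, hac, hbc⟩ := Finset.two_lt_card.mp h2
  have key : ∀ x y z : ZMod 4, ((y = x ∨ y = x + 1) ∨ (x = y ∨ x = y + 1)) ∨ ((z = x ∨ z = x + 1) ∨ (x = z ∨ x = z + 1)) ∨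
      ((z = y ∨ z = y + 1) ∨ (y = z ∨ y = z + 1)) := by decide
  rcases key (s a) (s b) (s c) with (h | h) | (h | h) | (h | h)
  · exact ⟨a, b, hab, h⟩
  · exact ⟨b, a, hab.symm, h⟩
  · exact ⟨a, c, hac, h⟩
  · exact ⟨c, a, hac.symm, h⟩
  · exact ⟨b, c, hbc, h⟩
  · exact ⟨c, b, hbc.symm, h⟩

omit [AddGroup B] in
/-- **ORIENTED SQUARES.**  Through every non-residual type `s` (`|B| ≥ 3`) there is a cross square whose three other corners have smaller
potential and a common upper end `u`, where `u` is the upper end of `s` unless `s` is balanced. [folklore] -/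
theorem exists_orientedSquare (h3 : 3 ≤ Fintype.card B) {s : Ty B} (hs : ¬ IsRes B s) :
    ∃ (u : ZMod 4) (p q : ZMod 2 × B), p.2 ≠ q.2 ∧ ((∀ w, IsMin B w s) ∨ IsUpper B u s) ∧
      (Phi B (flip B p s) < Phi B s ∧ IsUpper B u (flip B p s)) ∧ (Phi B (flip B q s) < Phi B s ∧ IsUpper B u (flip B q s)) ∧
      (Phi B (flip B q (flip B p s)) < Phi B s ∧ IsUpper B u (flip B q (flip B p s))) := by
  -- two coherent `±1` moves at distinct columns
  obtain ⟨u, b₁, b₂, e₁, e₂, hb, he₁, he₂, hor, hc₁, hc₂, hl₂⟩ : ∃ (u : ZMod 4) (b₁ b₂ : B) (e₁ e₂ : ZMod 4), b₁ ≠ b₂ ∧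
      (e₁ = 1 ∨ e₁ = -1) ∧ (e₂ = 1 ∨ e₂ = -1) ∧ ((∀ w, IsMin B w s) ∨ IsUpper B u s) ∧
      (IsUpper B u (s + Pi.single b₁ e₁) ∧ Phi B (s + Pi.single b₁ e₁) + 1 = Phi B s) ∧
      (IsUpper B u (s + Pi.single b₂ e₂) ∧ Phi B (s + Pi.single b₂ e₂) + 1 = Phi B s) ∧ lee (s b₂ + e₂ - u) + 1 = lee (s b₂ - u) := by
    by_cases hbal : ∀ w, IsMin B w s
    · -- balanced: two columns with values `x`, `x' ∈ {x, x+1}`, moved toward `{x-2, x-1}`; upper end `x - 1`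
      obtain ⟨b₁, b₂, hb, hv⟩ := exists_two_adjacent B h3 s
      have key : ∀ x : ZMod 4, (lee (x + -1 - (x - 1)) + 1 = lee (x - (x - 1)) ∧ lee (x + -1 - (x - 1 - 1)) + 1 = lee (x - (x - 1 - 1))) ∧
          (lee (x + 1 + 1 - (x - 1)) + 1 = lee (x + 1 - (x - 1)) ∧ lee (x + 1 + 1 - (x - 1 - 1)) + 1 = lee (x + 1 - (x - 1 - 1))) := by
        decide
      obtain ⟨⟨k1, k2⟩, ⟨k3, k4⟩⟩ := key (s b₁)
      rcases hv with hv | hv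
      · have k1' : lee (s b₂ + -1 - (s b₁ - 1)) + 1 = lee (s b₂ - (s b₁ - 1)) := by rw [hv]; exact k1
        have k2' : lee (s b₂ + -1 - (s b₁ - 1 - 1)) + 1 = lee (s b₂ - (s b₁ - 1 - 1)) := by rw [hv]; exact k2
        exact ⟨s b₁ - 1, b₁, b₂, -1, -1, hb, Or.inr rfl, Or.inr rfl, Or.inl hbal,
          isUpper_move_of_balanced B hbal _ b₁ (-1) (Or.inr rfl) k1 k2, isUpper_move_of_balanced B hbal _ b₂ (-1) (Or.inr rfl) k1' k2', k1'⟩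
      · have k3' : lee (s b₂ + 1 - (s b₁ - 1)) + 1 = lee (s b₂ - (s b₁ - 1)) := by rw [hv]; exact k3
        have k4' : lee (s b₂ + 1 - (s b₁ - 1 - 1)) + 1 = lee (s b₂ - (s b₁ - 1 - 1)) := by rw [hv]; exact k4
        exact ⟨s b₁ - 1, b₁, b₂, -1, 1, hb, Or.inr rfl, Or.inl rfl, Or.inl hbal,
          isUpper_move_of_balanced B hbal _ b₁ (-1) (Or.inr rfl) k1 k2, isUpper_move_of_balanced B hbal _ b₂ 1 (Or.inl rfl) k3' k4', k3'⟩
    · -- not balanced: two columns off the upper end, moved toward it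
      obtain ⟨u, hu⟩ := exists_isUpper B hbal
      obtain ⟨b₁, b₂, hb, h₁, h₂⟩ := exists_two_off' B h3 hs u
      obtain ⟨e₁, he₁, hl₁⟩ := exists_step_toward h₁
      obtain ⟨e₂, he₂, hl₂⟩ := exists_step_toward h₂
      exact ⟨u, b₁, b₂, e₁, e₂, hb, he₁, he₂, Or.inr hu, isUpper_move B hu b₁ e₁ he₁ hl₁, isUpper_move B hu b₂ e₂ he₂ hl₂, hl₂⟩
  -- places realising the moves, and the square
  obtain ⟨j₁, hj₁⟩ := exists_place (s b₁) e₁ he₁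
  obtain ⟨j₂, hj₂⟩ := exists_place (s b₂) e₂ he₂
  have hf₁ : flip B (j₁, b₁) s = s + Pi.single b₁ e₁ := by rw [flip_eq_add_single, hj₁]
  have hf₂ : flip B (j₂, b₂) s = s + Pi.single b₂ e₂ := by rw [flip_eq_add_single, hj₂]
  have hf : flip B (j₂, b₂) (flip B (j₁, b₁) s) = flip B (j₁, b₁) s + Pi.single b₂ e₂ := by
    rw [flip_eq_add_single B (j₂, b₂), flip_apply_of_ne B (j₁, b₁) s (Ne.symm hb), hj₂]
  have hl₂' : lee (flip B (j₁, b₁) s b₂ + e₂ - u) + 1 = lee (flip B (j₁, b₁) s b₂ - u) := by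
    rw [flip_apply_of_ne B (j₁, b₁) s (Ne.symm hb)]; exact hl₂
  have hc₁' : IsUpper B u (flip B (j₁, b₁) s) := by rw [hf₁]; exact hc₁.1
  have hc₁₂ := isUpper_move B hc₁' b₂ e₂ he₂ hl₂'
  have hP₁ : Phi B (flip B (j₁, b₁) s) + 1 = Phi B s := by rw [hf₁]; exact hc₁.2
  refine ⟨u, (j₁, b₁), (j₂, b₂), hb, hor, ⟨by omega, hc₁'⟩, ⟨?_, ?_⟩, ⟨?_, ?_⟩⟩
  · rw [hf₂]; omega
  · rw [hf₂]; exact hc₂.1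
  · have := hc₁₂.2; rw [hf]; omega
  · rw [hf]; exact hc₁₂.1

end Summit.HodgeConjecture.CorCM.Census.QuarticTwist
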